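import Literature.AlgebraicGeometry.Frobenioids.RealificationDataCanonical
import Literature.AlgebraicGeometry.Frobenioids.SupportsRealPowLinear
import HarnessLib

/-!
# Frobenioids I, Prop. 5.3 / Thm. 6.4 (i): an `ℝ`-linear functional killing `Φ^birat` kills `ℝ · Φ^birat`

Mochizuki, *The geometry of Frobenioids I*, Kyushu J. Math. **62** (2008), Prop. 5.3 p. 103 ("`(ℝ · Φ^birat)(A_D)`
is the `ℝ`-vector subspace of `(Φ^rlf)^gp(A_D)` generated by `Φ^birat(A_D)`") and Thm. 6.4 (i) p. 115 l. 27–33 (the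
degree `(Φ^rlf)^gp(L) → ℝ` vanishes on "the image via the natural map `Φ^birat(L) → Φ^rlf(L)` of `Φ^birat(L) ⊗_ℤ ℝ`",
so that it factors through `Pic_Φ(A) = (Φ^rlf)^gp(L)/(ℝ · Φ^birat)(L)`) [cite: MochizukiFrdI2008, Prop. 5.3 p.103]
[cite: MochizukiFrdI2008, Thm. 6.4 (i) p.115].

PROOF-ONLY.
* `RealificationData.realSpan_le_ker` — for ANY realification datum `R`: a homomorphism out of `(Φ^rlf)^gp(X)`
  whose kernel is stable under the scalars `r • (−)` and which kills `ι(Ψ(X))` kills `(ℝ · Ψ)(X)`;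
* `IsPerfFactorial.Rlf.monGpMap_realSMul` — for THE data (`Rlf.realSMul`) and an `ℝ_{≥0}`-valued `d : M^rlf → ℝ_{≥0}`:
  `d^gp (r • ξ) = r • d^gp(ξ)` (`ℝ`-linearity of degrees on `(M^rlf)^gp`, from `hom_nnreal_rpow` and
  `Supports.realPow_nnreal`), hence `ker d^gp` is `ℝ`-stable;
* `RealificationData.canonical_realSpan_le_ker` — so for THE realification data: **if `d^gp` kills `ι(Ψ(X))`
  (e.g. principal divisors have degree `0`: the product formula) then `d^gp` kills `(ℝ · Ψ)(X)`** — the degree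
  factors through `Pic`.
Universe note: `M`, `Φ(X)` in `Type` (the target `ℝ_{≥0}` is; `MonGp.map` is universe-homogeneous).
Seat abc-iut-L1-d2 (cell abc-iut).
-/

noncomputable section

namespace Literature.AlgebraicGeometry.Frobenioids

open CategoryTheory Opposite Function NNReal Literature.AnabelianGeometry.EtaleTheta

universe v u

namespace RealificationData

variable {D : Type u} [Category.{v} D] {Φ : Dᵒᵖ ⥤ CommMonCat.{0}} (R : RealificationData Φ)
  (Ψ : GpSubfunctor Φ)

/-- **`(ℝ · Ψ)(X) ⊆ ker D`** for every homomorphism `D` out of `(Φ^rlf)^gp(X)` whose kernel is stable under the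
scalars `r • (−)`, `r ∈ ℝ`, and which kills `ι(Ψ(X))` (the generators `r • ι(c)` of `ℝ · Ψ` then lie in the
kernel). [cite: MochizukiFrdI2008, Prop. 5.3 p.103] -/
theorem realSpan_le_ker (X : D) {G : Type*} [Group G]
    (Dg : Algebra.GrothendieckGroup (R.rlf.obj (op X)) →* G)
    (hker : ∀ (r : ℝ) (x : Algebra.GrothendieckGroup (R.rlf.obj (op X))), Dg x = 1 → Dg (R.rsmul X r x) = 1)
    (hΨ : ∀ c ∈ Ψ.carrier X, Dg (R.toRlfGp X c) = 1) :
    (R.realSpan Ψ).carrier X ≤ Dg.ker := by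
  show Subgroup.closure (R.realSpanGen Ψ X) ≤ Dg.ker
  rw [Subgroup.closure_le]
  rintro _ ⟨r, c, hc, rfl⟩
  exact hker r _ (hΨ c hc)

end RealificationData

namespace IsPerfFactorial.Rlf

variable {M : Type} [CommMonoid M] (h : IsPerfFactorial M)

/-- **Degrees are `ℝ`-linear on `(M^rlf)^gp`**: for `d : M^rlf → ℝ_{≥0}`, `d^gp(r • ξ) = r • d^gp(ξ)`, the scalar
action on `(ℝ_{≥0})^gp` being the one induced by the `ℝ_{>0}`-action of `ℝ_{≥0}` (Def. 2.4 (ii); = multiplication,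
`Supports.realPow_nnreal`). [cite: MochizukiFrdI2008, Def. 2.4(ii) p.48] -/
theorem monGpMap_realSMul (hS : Supports (Multiplicative ℝ≥0) MonoidType.R) (d : h.Rlf →* Multiplicative ℝ≥0)
    (r : ℝ) (ξ : Algebra.GrothendieckGroup h.Rlf) :
    MonGp.map d (realSMul h r ξ) = RealAction.gpSMul hS.realPow r (MonGp.map d ξ) :=
  RealAction.monGpMap_gpSMul (rpow h) hS.realPow d
    (fun s a => by rw [hom_nnreal_rpow' h d s a, ← ofAdd_toAdd (d a), Supports.realPow_nnreal, toAdd_ofAdd]) r ξ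

/-- Hence `ker d^gp ⊆ (M^rlf)^gp` is stable under the scalars `r • (−)`, `r ∈ ℝ`.
[cite: MochizukiFrdI2008, Def. 2.4(ii) p.48] -/
theorem monGpMap_realSMul_eq_one (hS : Supports (Multiplicative ℝ≥0) MonoidType.R)
    (d : h.Rlf →* Multiplicative ℝ≥0) {ξ : Algebra.GrothendieckGroup h.Rlf} (hξ : MonGp.map d ξ = 1) (r : ℝ) :
    MonGp.map d (realSMul h r ξ) = 1 := by
  rw [monGpMap_realSMul h hS d, hξ, map_one]

end IsPerfFactorial.Rlf

namespace RealificationData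

variable {D : Type u} [Category.{v} D] (Φ : Dᵒᵖ ⥤ CommMonCat.{0}) (hΦ : ∀ X : Dᵒᵖ, IsPerfFactorial (Φ.obj X))
  (Ψ : GpSubfunctor Φ)

/-- **For THE realification data: a degree `d : Φ^rlf(X) → ℝ_{≥0}` whose groupification kills `ι(Ψ(X))` kills
`(ℝ · Ψ)(X)`** — so it factors through `Pic = (Φ^rlf)^gp(X)/(ℝ · Ψ)(X)` (Thm. 6.4 (i): the arithmetic degree
vanishes on `ℝ · Φ^birat(L)` because it vanishes on principal divisors). [cite: MochizukiFrdI2008, Thm. 6.4 (i) p.115] -/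
theorem canonical_realSpan_le_ker (X : D) (hS : Supports (Multiplicative ℝ≥0) MonoidType.R)
    (d : (hΦ (op X)).Rlf →* Multiplicative ℝ≥0)
    (hΨ : ∀ c ∈ Ψ.carrier X, MonGp.map d ((canonical Φ hΦ).toRlfGp X c) = 1) :
    ((canonical Φ hΦ).realSpan Ψ).carrier X ≤ (MonGp.map d).ker :=
  (canonical Φ hΦ).realSpan_le_ker Ψ X (MonGp.map d)
    (fun r x hx => by
      rw [canonical_rsmul]
      exact IsPerfFactorial.Rlf.monGpMap_realSMul_eq_one (hΦ (op X)) hS d hx r) hΨ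

end RealificationData

end Literature.AlgebraicGeometry.Frobenioids
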